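import Mathlib
import Literature.AlgebraicGeometry.Resolution.TranscendenceDefect
import Literature.AlgebraicGeometry.Resolution.LocalBlowup
import Literature.AlgebraicGeometry.Resolution.AbhyankarMonomialUniformization
import Summits.ResolutionOfSingularities.ResolutionOfSingularities.Theorems.RadicialJungCleanModelsLocalMonomializationOfKnafKuhlmann
import Summits.ResolutionOfSingularities.ResolutionOfSingularities.Theorems.RadicialJungCleanModelsDimNonDiscreteConeNarrowed
import HarnessLib

/-!
# Route `RadicialJung`, crux `CleanModels` (stmt-15917), line `Sketch` rev 35, stub 7 `stub_cleanModelsDimGEFour`: the local-monomialization input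
# SPLIT along «Abhyankar with separable residue field» — the printed part (Knaf–Kuhlmann 2005 Thm. 1.1) carved out of `hMono_d`, every ground field

Explicit-unit seat `decomp-res-hand-2` g3 (structural hand, stubs 5–7).  OURS; nothing here proves resolution in characteristic `p`.

After ✓ `…DimOfLocalMonomialization`, ✓ `…LocalMonomializationOfKnafKuhlmann`, ✓ `…DimNonDiscreteConeNarrowed` (this seat), stub 7 reads
`stub_cleanModelsDimGEFour ⟸ hMono_d ∧ hNDcone_d ∧ hZ_d` (`d ≥ 4`), and `hMono_d` holds at Abhyankar places with separable residue field modulo the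
printed fact `Literature.AlgebraicGeometry.Resolution.KnafKuhlmann2005_Thm11_monomialForm`.  This file makes the split formal, over EVERY ground field:

* `localMonomialization_dim_of_knafKuhlmann d` — `hMono_d` ⟸ `KnafKuhlmann2005_Thm11_monomialForm` ∧ `hMonoRes_d`, where `hMonoRes_d` is `hMono_d`
  asked ONLY at valuation rings that are NOT «Abhyankar (transcendence defect `0`) with `κ(O)/k` separable» (excluded middle; the Abhyankar-separable
  case by ✓ `localMonomialization_of_knafKuhlmann`).
* `cleanModelsDimGEFour_of_knafKuhlmann_of_localMonomialization` — the registered stub `stub_cleanModelsDimGEFour` VERBATIM ⟸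
  `KnafKuhlmann2005_Thm11_monomialForm` (PRINT) ∧ `hMonoRes_d` ∧ `hNDcone_d` ∧ `hZ_d` (`d ≥ 4`).

Census reading: the residual local-uniformization input of stub 7 is `hMonoRes_d` = monomialization of finitely many elements of a regular
`d`-dimensional model along a zero-dimensional valuation that is EITHER non-Abhyankar (positive transcendence defect — Kuhlmann's defect world;
open for `d ≥ 4`, Cutkosky–Mourtada 2019) OR Abhyankar with INSEPARABLE residue field extension (imperfect ground fields only; Knaf–Kuhlmann 2005
needs `FP|K` separable, Temkin 2013 uniformizes only after a purely inseparable extension of the function field).  Over a perfect ground field the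
second alternative is empty at zero-dimensional valuations (`κ(O)/k` algebraic, hence separable).  Structural bookkeeping, counted 0.
-/

noncomputable section

set_option linter.dupNamespace false -- mandated namespace of this single-conjunct summit

open IsLocalRing AlgebraicGeometry CategoryTheory
open Literature.AlgebraicGeometry.Resolution Literature.AlgebraicGeometry.Motives

namespace Summit.ResolutionOfSingularities.ResolutionOfSingularities.Theorems.RadicialJung.CleanModels

/-- **`hMono_d` from Knaf–Kuhlmann 2005 Thm. 1.1 (with monomiality) and its residual part `hMonoRes_d`** (local monomialization asked only at
valuation rings that are not Abhyankar-with-separable-residue-field), every `d`, every ground field: excluded middle on «`transcendenceDefect = 0` ∧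
`κ(O)/k` separable», the positive case being ✓ `localMonomialization_of_knafKuhlmann`. [cite: KnafKuhlmann2005, Thm. 1.1] -/
theorem localMonomialization_dim_of_knafKuhlmann (d : ℕ)
    (hKK : Literature.AlgebraicGeometry.Resolution.KnafKuhlmann2005_Thm11_monomialForm.{0, 0})
    (hMonoRes : ∀ (k : Type) [Field k] (K : Type) [Field K] [Algebra k K]
    (O : ValuationSubring K) (A : Subalgebra k K), A.toSubring ≤ O.toSubring → A.FG → IsFractionRing A K →
    ringKrullDim A ≤ (d : WithBot ℕ∞) → IsRegularLocalRing (locAtCentre A.toSubring O) →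
    ringKrullDim (locAtCentre A.toSubring O) = (d : WithBot ℕ∞) →
    (∀ (T : Subring K) (hT : T ≤ O.toSubring), A.toSubring ≤ T → (subringCentre T O hT).IsMaximal) →
    (∀ hk : ∀ c : k, algebraMap k K c ∈ O, ¬ (transcendenceDefect k O hk = 0 ∧
      @Algebra.IsSeparable k (ResidueField O) _ _
        ((IsLocalRing.residue O).comp ((algebraMap k K).codRestrict O hk)).toAlgebra)) →
    ∀ Z : Finset K, (∀ z ∈ Z, z ∈ A) →
    ∃ (A' : Subalgebra k K), A'.toSubring ≤ O.toSubring ∧ A ≤ A' ∧ A'.FG ∧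
    ∃ (_ : IsRegularLocalRing (locAtCentre A'.toSubring O)) (e : ℕ) (a : Fin e → ↥(locAtCentre A'.toSubring O)),
      Ideal.span (Set.range a) = IsLocalRing.maximalIdeal ↥(locAtCentre A'.toSubring O) ∧
      ringKrullDim ↥(locAtCentre A'.toSubring O) = (e : WithBot ℕ∞) ∧
      ∀ z ∈ Z, z ≠ 0 → ∃ (v : ↥(locAtCentre A'.toSubring O)) (μ : Fin e → ℕ), IsUnit v ∧
        z = (v : K) * ∏ i, ((a i : ↥(locAtCentre A'.toSubring O)) : K) ^ (μ i)) :
    ∀ (k : Type) [Field k] (K : Type) [Field K] [Algebra k K]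
    (O : ValuationSubring K) (A : Subalgebra k K), A.toSubring ≤ O.toSubring → A.FG → IsFractionRing A K →
    ringKrullDim A ≤ (d : WithBot ℕ∞) → IsRegularLocalRing (locAtCentre A.toSubring O) →
    ringKrullDim (locAtCentre A.toSubring O) = (d : WithBot ℕ∞) →
    (∀ (T : Subring K) (hT : T ≤ O.toSubring), A.toSubring ≤ T → (subringCentre T O hT).IsMaximal) →
    ∀ Z : Finset K, (∀ z ∈ Z, z ∈ A) →
    ∃ (A' : Subalgebra k K), A'.toSubring ≤ O.toSubring ∧ A ≤ A' ∧ A'.FG ∧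
    ∃ (_ : IsRegularLocalRing (locAtCentre A'.toSubring O)) (e : ℕ) (a : Fin e → ↥(locAtCentre A'.toSubring O)),
      Ideal.span (Set.range a) = IsLocalRing.maximalIdeal ↥(locAtCentre A'.toSubring O) ∧
      ringKrullDim ↥(locAtCentre A'.toSubring O) = (e : WithBot ℕ∞) ∧
      ∀ z ∈ Z, z ≠ 0 → ∃ (v : ↥(locAtCentre A'.toSubring O)) (μ : Fin e → ℕ), IsUnit v ∧
        z = (v : K) * ∏ i, ((a i : ↥(locAtCentre A'.toSubring O)) : K) ^ (μ i) := by
  intro k _ K _ _ O A hAO hAfg hfrac hdimA hreg hdim hzd Z hZ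
  have hk : ∀ c : k, algebraMap k K c ∈ O := fun c => hAO (A.algebraMap_mem c)
  by_cases hAbhSep : transcendenceDefect k O hk = 0 ∧
      @Algebra.IsSeparable k (ResidueField O) _ _ ((IsLocalRing.residue O).comp ((algebraMap k K).codRestrict O hk)).toAlgebra
  · exact localMonomialization_of_knafKuhlmann hKK k K O A hAO hAfg hfrac hk hAbhSep.1 hAbhSep.2 Z hZ
  · exact hMonoRes k K O A hAO hAfg hfrac hdimA hreg hdim hzd (fun _ => hAbhSep) Z hZ

/-- **The frontier stub `stub_cleanModelsDimGEFour` (statement VERBATIM) ⟸ Knaf–Kuhlmann 2005 Thm. 1.1 with monomiality (PRINT) ∧ `hMonoRes_d` ∧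
`hNDcone_d` ∧ `hZ_d` for every `d ≥ 4`**: ✓ `cleanModelsDimGEFour_of_localMonomialization_coneNarrowed` with `hMono_d` split by
`localMonomialization_dim_of_knafKuhlmann`.  `hMonoRes_d` (local monomialization at zero-dimensional valuations that are non-Abhyankar, or Abhyankar
with inseparable residue field), `hNDcone_d` (class (B) in dimension `d`, smooth-cone-narrowed) and `hZ_d` (Piltant patching for `P_clean`) are OPEN for
`d ≥ 4`; the first hypothesis is a printed theorem whose discharge from the tree is in progress.  Structural reduction only.
[cite: KnafKuhlmann2005, Thm. 1.1] [cite: Piltant2013, Cor. 5.7 and p. 2] [cite: CutkoskyMourtada2019, Def. 1.2] -/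
theorem cleanModelsDimGEFour_of_knafKuhlmann_of_localMonomialization
    (hKK : Literature.AlgebraicGeometry.Resolution.KnafKuhlmann2005_Thm11_monomialForm.{0, 0})
    (hMonoRes : ∀ d : ℕ, 4 ≤ d → ∀ (k : Type) [Field k] (K : Type) [Field K] [Algebra k K]
    (O : ValuationSubring K) (A : Subalgebra k K), A.toSubring ≤ O.toSubring → A.FG → IsFractionRing A K →
    ringKrullDim A ≤ (d : WithBot ℕ∞) → IsRegularLocalRing (locAtCentre A.toSubring O) →
    ringKrullDim (locAtCentre A.toSubring O) = (d : WithBot ℕ∞) →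
    (∀ (T : Subring K) (hT : T ≤ O.toSubring), A.toSubring ≤ T → (subringCentre T O hT).IsMaximal) →
    (∀ hk : ∀ c : k, algebraMap k K c ∈ O, ¬ (transcendenceDefect k O hk = 0 ∧
      @Algebra.IsSeparable k (ResidueField O) _ _
        ((IsLocalRing.residue O).comp ((algebraMap k K).codRestrict O hk)).toAlgebra)) →
    ∀ Z : Finset K, (∀ z ∈ Z, z ∈ A) →
    ∃ (A' : Subalgebra k K), A'.toSubring ≤ O.toSubring ∧ A ≤ A' ∧ A'.FG ∧
    ∃ (_ : IsRegularLocalRing (locAtCentre A'.toSubring O)) (e : ℕ) (a : Fin e → ↥(locAtCentre A'.toSubring O)),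
      Ideal.span (Set.range a) = IsLocalRing.maximalIdeal ↥(locAtCentre A'.toSubring O) ∧
      ringKrullDim ↥(locAtCentre A'.toSubring O) = (e : WithBot ℕ∞) ∧
      ∀ z ∈ Z, z ≠ 0 → ∃ (v : ↥(locAtCentre A'.toSubring O)) (μ : Fin e → ℕ), IsUnit v ∧
        z = (v : K) * ∏ i, ((a i : ↥(locAtCentre A'.toSubring O)) : K) ^ (μ i))
    (hND' : ∀ d : ℕ, 4 ≤ d → ∀ (p : ℕ), p.Prime →
    ∀ (k : Type) [Field k] [CharP k p] (K : Type) [Field K] [Algebra k K]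
    (O : ValuationSubring K) (A : Subalgebra k K), A.toSubring ≤ O.toSubring → A.FG → IsFractionRing A K →
    ringKrullDim A ≤ (d : WithBot ℕ∞) → IsRegularLocalRing (locAtCentre A.toSubring O) →
    ringKrullDim (locAtCentre A.toSubring O) = (d : WithBot ℕ∞) →
    (∀ (T : Subring K) (hT : T ≤ O.toSubring), A.toSubring ≤ T → (subringCentre T O hT).IsMaximal) →
    ∀ g₀ : K, (∀ c : K, c ^ p ≠ g₀) →
    (∀ f₀ : K, ∃ f₁ : K, O.valuation (g₀ - f₁ ^ p) < O.valuation (g₀ - f₀ ^ p)) →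
    (∀ hk : ∀ c : k, algebraMap k K c ∈ O, transcendenceDefect k O hk ≠ 0) →
    ¬ (∃ π : K, π ≠ 0 ∧ (∀ x : K, O.valuation x < 1 → O.valuation x ≤ O.valuation π) ∧
      (∀ x : K, x ≠ 0 → ∃ n : ℕ, O.valuation π ^ n ≤ O.valuation x)) →
    ¬ (∃ (A' : Subalgebra k K) (_ : A'.toSubring ≤ O.toSubring) (_ : A ≤ A') (_ : A'.FG)
      (_ : IsRegularLocalRing (locAtCentre A'.toSubring O)) (c : Fin p → K) (_ : ∃ j : Fin p, (j : ℕ) ≠ 0 ∧ c j ≠ 0)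
      (h : ↥(locAtCentre A'.toSubring O)) (_ : (∑ j : Fin p, c j ^ p * g₀ ^ (j : ℕ)) = (h : K))
      (d : ℕ) (_ : 0 < d) (_ : (IsLocalRing.maximalIdeal ↥(locAtCentre A'.toSubring O)).spanFinrank = d)
      (t : Fin d → ↥(locAtCentre A'.toSubring O))
      (_ : Ideal.span (Set.range t) = IsLocalRing.maximalIdeal ↥(locAtCentre A'.toSubring O))
      (F : MvPolynomial (Fin d) ↥(locAtCentre A'.toSubring O)) (e N : ℕ) (_ : F.IsHomogeneous e) (_ : ¬ p ∣ e) (_ : e ≤ N + 1),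
      h - MvPolynomial.aeval t F ∈ IsLocalRing.maximalIdeal ↥(locAtCentre A'.toSubring O) ^ (e + 1) ∧
      ∀ i, ∃ b : Fin d → ↥(locAtCentre A'.toSubring O),
        (∀ l, b l ∈ IsLocalRing.maximalIdeal ↥(locAtCentre A'.toSubring O) ^ (N + 1 - e)) ∧
        t i ^ N - ∑ l, b l * MvPolynomial.aeval t (MvPolynomial.pderiv l F) ∈
          IsLocalRing.maximalIdeal ↥(locAtCentre A'.toSubring O) ^ (N + 1)) →
    ∃ (A' : Subalgebra k K), A'.toSubring ≤ O.toSubring ∧ A ≤ A' ∧ A'.FG ∧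
    ∃ (_ : IsRegularLocalRing (locAtCentre A'.toSubring O)) (c : Fin p → K), (∃ j : Fin p, (j : ℕ) ≠ 0 ∧ c j ≠ 0) ∧
    ((∃ (d m : ℕ) (hmd : m ≤ d) (t : Fin d → ↥(locAtCentre A'.toSubring O)) (a : Fin m → ℕ) (u : ↥(locAtCentre A'.toSubring O)), IsUnit u ∧
    Ideal.span (Set.range t) = IsLocalRing.maximalIdeal ↥(locAtCentre A'.toSubring O) ∧
    ringKrullDim ↥(locAtCentre A'.toSubring O) = (d : WithBot ℕ∞) ∧ 0 < m ∧ (∀ i, ¬ p ∣ a i) ∧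
    (∑ j : Fin p, c j ^ p * g₀ ^ (j : ℕ)) = (u : K) * ∏ i : Fin m, ((t (Fin.castLE hmd i) : ↥(locAtCentre A'.toSubring O)) : K) ^ (a i)) ∨
    (∃ u : ↥(locAtCentre A'.toSubring O), IsUnit u ∧ (∑ j : Fin p, c j ^ p * g₀ ^ (j : ℕ)) = (u : K) ∧
    ∀ c' : ↥(locAtCentre A'.toSubring O), u - c' ^ p ∉ IsLocalRing.maximalIdeal ↥(locAtCentre A'.toSubring O)) ∨
    (∃ s c' : ↥(locAtCentre A'.toSubring O), (∑ j : Fin p, c j ^ p * g₀ ^ (j : ℕ)) = (s : K) ∧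
    s - c' ^ p ∈ IsLocalRing.maximalIdeal ↥(locAtCentre A'.toSubring O) ∧
    s - c' ^ p ∉ IsLocalRing.maximalIdeal ↥(locAtCentre A'.toSubring O) ^ 2)))
    (hZ : ∀ d : ℕ, 4 ≤ d → ∀ (p : ℕ), p.Prime → ∀ (k K : Type) [Field k] [CharP k p] [Field K] [Algebra k K]
    [Algebra.EssFiniteType k K],
    Algebra.trdeg k K = d → ∀ (g₀ : K) (M₁ M₂ : ProjModel k K) (U₁ : M₁.X.Opens) (U₂ : M₂.X.Opens),
    (∀ x ∈ U₁, ModelCleanRegAt p g₀ M₁ x) → (∀ x ∈ U₂, ModelCleanRegAt p g₀ M₂ x) →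
    ∃ (N : ProjModel k K) (φ₁ : N.Hom M₁) (φ₂ : N.Hom M₂),
    (∀ y : N.X, φ₁.f y ∈ U₁ → ModelCleanRegAt p g₀ N y) ∧ (∀ y : N.X, φ₂.f y ∈ U₂ → ModelCleanRegAt p g₀ N y)) :
    ∀ p : ℕ, p.Prime → ∀ (k : Type) [Field k] [CharP k p] (W : AlgebraicGeometry.Scheme.{0}) [AlgebraicGeometry.IsIntegral W] (f : W ⟶ AlgebraicGeometry.Spec (.of k)) (L : Type) [Field L] [Algebra W.functionField L], AlgebraicGeometry.IsSeparated f → AlgebraicGeometry.LocallyOfFiniteType f → AlgebraicGeometry.QuasiCompact f → Literature.AlgebraicGeometry.Resolution.Scheme.IsRegular W → IsPurelyInseparable W.functionField L → Module.finrank W.functionField L = p → ¬ topologicalKrullDim W ≤ 3 → ∃ (V : AlgebraicGeometry.Scheme.{0}) (π : V ⟶ W) (_ : AlgebraicGeometry.IsIntegral V) (_ : AlgebraicGeometry.IsDominant π), AlgebraicGeometry.IsProper π ∧ Literature.AlgebraicGeometry.Resolution.IsBirational π ∧ Literature.AlgebraicGeometry.Resolution.Scheme.IsRegular V ∧ (∀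 v : V, (∃ (y : L) (g : W.functionField), y ∉ Set.range (algebraMap W.functionField L) ∧ algebraMap W.functionField L g = y ^ p ∧ ((∃ (d m : ℕ) (hmd : m ≤ d) (t : Fin d → V.presheaf.stalk v) (a : Fin m → ℕ), Ideal.span (Set.range t) = IsLocalRing.maximalIdeal (V.presheaf.stalk v) ∧ ringKrullDim (V.presheaf.stalk v) = (d : WithBot ℕ∞) ∧ 0 < m ∧ (∀ i, ¬ p ∣ a i) ∧ Literature.AlgebraicGeometry.Motives.RatFn.functionFieldMap π g = ∏ i : Fin m, (algebraMap (V.presheaf.stalk v) V.functionField (t (Fin.castLE hmd i))) ^ (a i)) ∨ (∃ u₀ : V.presheaf.stalk v, IsUnit u₀ ∧ Literature.AlgebraicGeometry.Motives.RatFn.functionFieldMap π g = algebraMap (V.presheaf.stalk v) V.functionField u₀ ∧ ((∀ c : V.presheaf.stalk v, u₀ - c ^ p ∉ IsLocalRing.maximalIdeal (V.presheaf.stalk v)) ∨ (∃ c : V.presheaf.stalk v, u₀ - c ^ p ∈ IsLocalRing.maximalIdeal (V.presheaf.stalk v) ∧ u₀ - c ^ p ∉ IsLocalRing.maximalIdeal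 (V.presheaf.stalk v) ^ 2)))))) :=
  cleanModelsDimGEFour_of_localMonomialization_coneNarrowed
    (fun d hd => localMonomialization_dim_of_knafKuhlmann d hKK (hMonoRes d hd)) hND' hZ

end Summit.ResolutionOfSingularities.ResolutionOfSingularities.Theorems.RadicialJung.CleanModels

end
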